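import Literature.MathematicalPhysics.QuantumLattice.HubbardNNNHoppingInteraction
import HarnessLib

/-!
# The third-neighbour (`t''`, axial range-2) hopping of the one-band cuprate model on `ℤ^d` as a
# finite-range `FermionInteraction`

Topic `Literature/MathematicalPhysics/QuantumLattice`. Companion of `HubbardFermionInteractionTerms.lean`
(nearest-neighbour Hubbard interaction) and `HubbardNNNHoppingInteraction.lean` (diagonal `t'` hopping):
the THIRD term of the one-electron part of the one-band model of the cuprates,
`ε(k) = −2t(cos k_x + cos k_y) + 4t' cos k_x cos k_y − 2t''(cos 2k_x + cos 2k_y) + …`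
(Pavarini–Dasgupta–Saha-Dasgupta–Jepsen–Andersen, PRL 87 (2001) 047003, eq. (1)), i.e. in real
space the hopping `−t'' Σ_σ (c†_{xσ} c_{x+2e_i,σ} + h.c.)` along the lattice axes to the sites at
distance `2` (the sign convention of the tree's Hubbard terms `−t Σ(c†c + h.c.)`; the cuprate `t''` of
the downfolding literature is `> 0` in it, e.g. `t''/t ≈ 0.09` for La₂CuO₄, `≈ 0.13` for HgBa₂CuO₄):

* `axial2Vec i = 2e_i` — the axial range-2 jump vectors of `ℤ^d` (facts: nonzero, injective,
  `2e_i + 2e_j ≠ 0`, `± 2e_i ∈ [-2,2]^d = thicken {0} 2`);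
* `axialRange2HoppingFermionInteraction d t''` — the even, Hermitian interaction
  `Φ {x, x + 2e_i} = −t'' Σ_σ (c†_{xσ} c_{x+2e_i,σ} + c†_{x+2e_i,σ} c_{xσ})`, `Φ X = 0` otherwise, with its
  cases (`_apply_pair`, `_apply_eq_zero`, vanishing on singletons / nearest-neighbour pairs / diagonal
  pairs, and the Hubbard and diagonal interactions vanishing on axial range-2 pairs) and its scaling in
  `t''` (`_smul_apply`: `Φ^{c t''} = c Φ^{t''}`, the pencil hook). The mean-energy observable at range `2`,
  its norm bound `‖E_Φ‖ ≤ 4 d |t''|` and the `t–t'–t''` pencil are in `HubbardTTPrimeTPPInteraction.lean`.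

Written for the Hubbard material-oracle programme (cell `pub/hubbard-downfold`, seat hubbard-downfold-mod-1,
the S1/S2 seam in the `t''` direction: a material's one-band box carries the coordinate `tpp/t`; with this
file the `t–t'–t''` interaction is the pencil
`(hubbardTTPrimeFermionInteraction t t' U).pencil (axialRange2HoppingFermionInteraction 2 1) t''`
(`HubbardTTPrimeTPPInteraction.lean`), so concavity and Lipschitz continuity of the translation-invariant
ground-state energy density in `t''` are instances of `TIGroundEnergyDensityResponse`).
Everything is PROVED; the one definition is the interaction term itself.

## What is NOT here

Finite range `2` / translation covariance as the tree's predicates (not needed downstream, as for the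
`t`, `t'` terms); the mean-energy observable (companion file); the torus identification of the
translates of `E_Φ` (pattern `HubbardNNNHoppingInteractionTorus.lean`); any torus-limit energy density
`e(t, t', t'', U, n)`.

## References
* E. Pavarini, I. Dasgupta, T. Saha-Dasgupta, O. Jepsen, O. K. Andersen, *Band-structure trend in
  hole-doped cuprates and correlation with `T_c max`*, Phys. Rev. Lett. 87 (2001) 047003, eq. (1)
  (the one-band dispersion with `t, t', t''`). [cite: PavariniEtAl2001, eq. (1)]
* H. Araki, H. Moriya, Rev. Math. Phys. 15 (2003) 93, §5.1 (even finite-range potentials).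
  [cite: ArakiMoriya2003, §5.1]
-/

noncomputable section

namespace Literature.MathematicalPhysics.QuantumLattice

open Matrix Finset HubbardWave0 Literature.Probability.LatticeModels

variable {d : ℕ}

/-! ### The axial range-2 jump vectors of `ℤ^d` -/

/-- The axial range-2 jump vector `2e_i ∈ ℤ^d` (third neighbours of the square lattice, the `t''`
bonds of Pavarini et al. (2001) eq. (1)). [cite: PavariniEtAl2001, eq. (1)] -/
def axial2Vec (i : Fin d) : Site d := Pi.single i 2

/-- `(2e_i)_i = 2`. [cite: PavariniEtAl2001, eq. (1)] -/
@[simp] theorem axial2Vec_apply_self (i : Fin d) : axial2Vec i i = 2 := by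
  simp [axial2Vec]

/-- `(2e_i)_j = 0` for `j ≠ i`. [cite: PavariniEtAl2001, eq. (1)] -/
theorem axial2Vec_apply_of_ne {i j : Fin d} (h : j ≠ i) : axial2Vec i j = 0 := by
  simp [axial2Vec, Pi.single_eq_of_ne h]

/-- `2e_i = e_i + e_i`. [cite: PavariniEtAl2001, eq. (1)] -/
theorem axial2Vec_eq_unitVec_add_unitVec (i : Fin d) : axial2Vec i = unitVec i + unitVec i := by
  rw [axial2Vec, unitVec, ← Pi.single_add]
  norm_num

/-- `2e_i ≠ 0`. [cite: PavariniEtAl2001, eq. (1)] -/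
theorem axial2Vec_ne_zero (i : Fin d) : axial2Vec i ≠ 0 := fun h => by
  have := congrFun h i
  rw [axial2Vec_apply_self] at this
  norm_num at this

/-- `2e_i + 2e_j ≠ 0` (its `i`-th coordinate is `2` or `4`). [cite: PavariniEtAl2001, eq. (1)] -/
theorem axial2Vec_add_axial2Vec_ne_zero (i j : Fin d) : axial2Vec i + axial2Vec j ≠ 0 := fun h => by
  have := congrFun h i
  rw [Pi.add_apply, axial2Vec_apply_self] at this
  rcases eq_or_ne i j with rfl | hne
  · rw [axial2Vec_apply_self] at this; norm_num at this
  · rw [axial2Vec_apply_of_ne hne] at this; norm_num at this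

/-- `i ↦ 2e_i` is injective. [cite: PavariniEtAl2001, eq. (1)] -/
theorem axial2Vec_injective : Function.Injective (axial2Vec : Fin d → Site d) := by
  intro i j h
  by_contra hne
  have := congrFun h i
  rw [axial2Vec_apply_self, axial2Vec_apply_of_ne hne] at this
  norm_num at this

/-- `x ≠ x + 2e_i`. [cite: PavariniEtAl2001, eq. (1)] -/
theorem self_ne_add_axial2Vec (x : Site d) (i : Fin d) : x ≠ x + axial2Vec i := fun h =>
  axial2Vec_ne_zero i (left_eq_add.1 h)

/-- `x + 2e_i + 2e_j ≠ x`. [cite: PavariniEtAl2001, eq. (1)] -/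
theorem add_axial2Vec_add_axial2Vec_ne_self (x : Site d) (i j : Fin d) :
    x + axial2Vec i + axial2Vec j ≠ x := by
  intro h
  rw [add_assoc, add_eq_left] at h
  exact axial2Vec_add_axial2Vec_ne_zero i j h

/-- `2e_i ∈ [-2,2]^d = thicken {0} 2` (sup metric ball of radius `2`). [cite: FriedliVelenik2017, §3.1] -/
theorem axial2Vec_mem_thicken_two (i : Fin d) : axial2Vec i ∈ thicken ({0} : Finset (Site d)) 2 := by
  rw [thicken, Finset.singleton_biUnion, Nat.floor_ofNat]
  refine mem_image.2 ⟨axial2Vec i, ?_, zero_add _⟩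
  rw [mem_box]
  intro j
  by_cases hj : j = i
  · subst hj; simp
  · rw [axial2Vec_apply_of_ne hj]; norm_num

/-- `-2e_i ∈ [-2,2]^d = thicken {0} 2`. [cite: FriedliVelenik2017, §3.1] -/
theorem neg_axial2Vec_mem_thicken_two (i : Fin d) : -axial2Vec i ∈ thicken ({0} : Finset (Site d)) 2 := by
  rw [thicken, Finset.singleton_biUnion, Nat.floor_ofNat]
  refine mem_image.2 ⟨-axial2Vec i, ?_, zero_add _⟩
  rw [mem_box]
  intro j
  by_cases hj : j = i
  · subst hj; simp
  · rw [Pi.neg_apply, axial2Vec_apply_of_ne hj]; norm_num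

/-- `{0, 2e_i} ⊆ thicken {0} 2`. [cite: FriedliVelenik2017, §3.1] -/
theorem pair_axial2Vec_subset_thicken_two (i : Fin d) :
    ({0, 0 + axial2Vec i} : Finset (Site d)) ⊆ thicken ({0} : Finset (Site d)) 2 := by
  rw [zero_add]
  exact insert_subset (zero_mem_thicken_zero 2) (singleton_subset_iff.2 (axial2Vec_mem_thicken_two i))

/-- `{-2e_i, 0} ⊆ thicken {0} 2`. [cite: FriedliVelenik2017, §3.1] -/
theorem pair_neg_axial2Vec_subset_thicken_two (i : Fin d) :
    ({-axial2Vec i, -axial2Vec i + axial2Vec i} : Finset (Site d)) ⊆ thicken ({0} : Finset (Site d)) 2 := by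
  rw [neg_add_cancel]
  exact insert_subset (neg_axial2Vec_mem_thicken_two i) (singleton_subset_iff.2 (zero_mem_thicken_zero 2))

/-- Two bond pairs `{y, y + u} = {x, x + v}` with nonzero jumps have `u = ± v`. [folklore] -/
private theorem eq_or_eq_neg_of_pair_eq_pair {y u x v : Site d} (hu : u ≠ 0)
    (h : ({y, y + u} : Finset (Site d)) = {x, x + v}) : u = v ∨ u = -v := by
  have hy : y ∈ ({x, x + v} : Finset (Site d)) := h ▸ mem_insert_self _ _
  have hyu : y + u ∈ ({x, x + v} : Finset (Site d)) := h ▸ mem_insert_of_mem (mem_singleton_self _)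
  rw [mem_insert, mem_singleton] at hy hyu
  rcases hy with rfl | rfl
  · rcases hyu with h' | h'
    · exact absurd (add_eq_left.1 h') hu
    · exact Or.inl (add_left_cancel h')
  · rcases hyu with h' | h'
    · refine Or.inr ?_
      rw [add_assoc, add_eq_left] at h'
      exact eq_neg_of_add_eq_zero_right h'
    · rw [add_assoc, add_right_inj, add_eq_left] at h'
      exact absurd h' hu

/-! ### The axial range-2 hopping interaction -/

/-- **The third-neighbour (axial range-2) hopping interaction** with amplitude `t''`:
`Φ {x, x + 2e_i} = -t'' Σ_σ (c†_{xσ} c_{x+2e_i,σ} + c†_{x+2e_i,σ} c_{xσ})`, `Φ X = 0` for every other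
`X` — an even, Hermitian, range-`2`, translation-covariant `FermionInteraction d`; for `d = 2` the
`t''`-term `−2t''(cos 2k_x + cos 2k_y)` of the one-band cuprate dispersion, Pavarini et al. (2001)
eq. (1), in the fermionic-potential format of Araki–Moriya §5.1. [cite: PavariniEtAl2001, eq. (1)] -/
def axialRange2HoppingFermionInteraction (d : ℕ) (t'' : ℝ) : FermionInteraction d where
  Φ X :=
    ∑ x ∈ X.attach, ∑ y ∈ X.attach,
      if (∃ i : Fin d, y.1 = x.1 + axial2Vec i) ∧ X = {x.1, y.1} then
        -(t'' : ℂ) • ∑ σ : Fin 2, ((cAt x.1 x.2 σ)ᴴ * cAt y.1 y.2 σ + (cAt y.1 y.2 σ)ᴴ * cAt x.1 x.2 σ)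
      else 0

/-- **The axial range-2 hopping interaction is even.** [cite: ArakiMoriya2003, §1 assumption (II)] -/
theorem axialRange2HoppingFermionInteraction_isEven (t'' : ℝ) :
    (axialRange2HoppingFermionInteraction d t'').IsEven := by
  intro X
  have hc : ∀ (x y : Site d) (hx : x ∈ X) (hy : y ∈ X) (σ : Fin 2),
      parityAut ((cAt x hx σ)ᴴ * cAt y hy σ) = (cAt x hx σ)ᴴ * cAt y hy σ := by
    intro x y hx hy σ
    rw [cAt, cAt, annihilation_conjTranspose, map_mul, parityAut_creation, parityAut_annihilation,
      neg_mul_neg]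
  simp only [axialRange2HoppingFermionInteraction, map_sum, apply_ite parityAut, map_zero, map_smul,
    map_add, hc]

/-- **The axial range-2 hopping interaction is Hermitian** (real `t''`). [cite: PavariniEtAl2001, eq. (1)] -/
theorem axialRange2HoppingFermionInteraction_isHermitian (t'' : ℝ) :
    (axialRange2HoppingFermionInteraction d t'').IsHermitian := by
  intro X
  have hc : ∀ (x y : Site d) (hx : x ∈ X) (hy : y ∈ X) (σ : Fin 2),
      ((cAt x hx σ)ᴴ * cAt y hy σ + (cAt y hy σ)ᴴ * cAt x hx σ)ᴴ =
        (cAt x hx σ)ᴴ * cAt y hy σ + (cAt y hy σ)ᴴ * cAt x hx σ := by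
    intro x y hx hy σ
    rw [Matrix.conjTranspose_add, Matrix.conjTranspose_mul, Matrix.conjTranspose_mul,
      Matrix.conjTranspose_conjTranspose, Matrix.conjTranspose_conjTranspose, add_comm]
  unfold Matrix.IsHermitian axialRange2HoppingFermionInteraction
  simp only [Matrix.conjTranspose_sum, apply_ite Matrix.conjTranspose, Matrix.conjTranspose_zero,
    Matrix.conjTranspose_smul, hc, Complex.star_def, map_neg, Complex.conj_ofReal]

/-- **Scaling in the amplitude** (the pencil hook): `Φ^{c·t''} X = c • Φ^{t''} X`; in particular
`Φ^{t''} = t'' • Φ^{1}`. [cite: PavariniEtAl2001, eq. (1)] -/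
theorem axialRange2HoppingFermionInteraction_smul_apply (c t'' : ℝ) (X : Finset (Site d)) :
    (axialRange2HoppingFermionInteraction d (c * t'')).Φ X =
      (c : ℂ) • (axialRange2HoppingFermionInteraction d t'').Φ X := by
  simp only [axialRange2HoppingFermionInteraction, Finset.smul_sum, smul_ite, smul_zero, smul_smul,
    Complex.ofReal_mul, mul_neg]

section Terms

variable (t'' : ℝ)

/-- **Axial range-2 bond term**: `Φ {x, x + 2e_i} = -t'' Σ_σ (c†_{xσ} c_{x+2e_i,σ} + c†_{x+2e_i,σ} c_{xσ})`.
[cite: PavariniEtAl2001, eq. (1)] -/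
theorem axialRange2HoppingFermionInteraction_apply_pair (x : Site d) (i : Fin d) :
    (axialRange2HoppingFermionInteraction d t'').Φ {x, x + axial2Vec i} =
      -(t'' : ℂ) • ∑ σ : Fin 2,
        ((cAt x (mem_insert_self _ _) σ)ᴴ *
            cAt (x + axial2Vec i) (mem_insert_of_mem (mem_singleton_self _)) σ +
          (cAt (x + axial2Vec i) (mem_insert_of_mem (mem_singleton_self _)) σ)ᴴ *
            cAt x (mem_insert_self _ _) σ) := by
  have hmem : ∀ {a : Site d}, a ∈ ({x, x + axial2Vec i} : Finset (Site d)) ↔ a = x ∨ a = x + axial2Vec i :=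
    fun {a} => by rw [mem_insert, mem_singleton]
  simp only [axialRange2HoppingFermionInteraction]
  rw [Finset.sum_eq_single ⟨x, mem_insert_self _ _⟩]
  · rw [Finset.sum_eq_single ⟨x + axial2Vec i, mem_insert_of_mem (mem_singleton_self _)⟩,
      if_pos ⟨⟨i, rfl⟩, rfl⟩]
    · rintro ⟨b, hb⟩ - hne
      refine if_neg ?_
      rintro ⟨⟨j, hj⟩, -⟩
      rcases hmem.1 hb with rfl | rfl
      · exact self_ne_add_axial2Vec _ j hj
      · exact hne rfl
    · intro h
      exact absurd (mem_attach _ _) h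
  · rintro ⟨a, ha⟩ - hne
    refine Finset.sum_eq_zero fun b _ => if_neg ?_
    rintro ⟨⟨j, hj⟩, -⟩
    rcases hmem.1 ha with rfl | rfl
    · exact hne rfl
    · rcases hmem.1 b.2 with hb | hb
      · exact add_axial2Vec_add_axial2Vec_ne_self _ i j (hj.symm.trans hb)
      · exact self_ne_add_axial2Vec _ j (hb.symm.trans hj)
  · intro h
    exact absurd (mem_attach _ _) h

/-- **All other terms vanish**: if `X` is not an axial range-2 pair `{x, x + 2e_i}`, then `Φ X = 0`.
[cite: PavariniEtAl2001, eq. (1)] -/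
theorem axialRange2HoppingFermionInteraction_apply_eq_zero {X : Finset (Site d)}
    (h2 : ∀ (x : Site d) (i : Fin d), X ≠ {x, x + axial2Vec i}) :
    (axialRange2HoppingFermionInteraction d t'').Φ X = 0 := by
  have hB : ∀ a b : Site d, ¬ ((∃ i : Fin d, b = a + axial2Vec i) ∧ X = {a, b}) := by
    rintro a b ⟨⟨i, rfl⟩, h⟩
    exact h2 a i h
  simp only [axialRange2HoppingFermionInteraction, hB, if_false, sum_const_zero]

/-- A singleton is not an axial range-2 pair. [folklore] -/
private theorem singleton_ne_pair_axial2Vec (y x : Site d) (i : Fin d) :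
    ({y} : Finset (Site d)) ≠ {x, x + axial2Vec i} := by
  intro h
  have := congrArg Finset.card h
  rw [card_singleton, card_pair (self_ne_add_axial2Vec x i)] at this
  exact absurd this (by norm_num)

/-- A nearest-neighbour pair is not an axial range-2 pair (`e_j ≠ ± 2e_i`: compare the `i`-th
coordinates). [folklore] -/
private theorem pair_unitVec_ne_pair_axial2Vec (y : Site d) (j : Fin d) (x : Site d) (i : Fin d) :
    ({y, y + unitVec j} : Finset (Site d)) ≠ {x, x + axial2Vec i} := by
  intro h
  have key := eq_or_eq_neg_of_pair_eq_pair (u := unitVec j) (uvec_ne_zero j) h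
  have h2 : (axial2Vec i : Site d) i = 2 := axial2Vec_apply_self i
  have h1 : (unitVec j : Site d) i = 2 ∨ (unitVec j : Site d) i = -2 := by
    rcases key with k | k
    · exact Or.inl (by rw [k, h2])
    · exact Or.inr (by rw [k, Pi.neg_apply, h2])
  by_cases hij : i = j
  · subst hij
    simp at h1
  · rw [show (unitVec j : Site d) i = 0 from Pi.single_eq_of_ne hij _] at h1
    norm_num at h1

/-- The axial range-2 hopping interaction vanishes on singletons. [cite: PavariniEtAl2001, eq. (1)] -/
theorem axialRange2HoppingFermionInteraction_apply_singleton (x : Site d) :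
    (axialRange2HoppingFermionInteraction d t'').Φ {x} = 0 :=
  axialRange2HoppingFermionInteraction_apply_eq_zero t'' fun y i => singleton_ne_pair_axial2Vec x y i

/-- The axial range-2 hopping interaction vanishes on nearest-neighbour pairs.
[cite: PavariniEtAl2001, eq. (1)] -/
theorem axialRange2HoppingFermionInteraction_apply_pair_unitVec (x : Site d) (j : Fin d) :
    (axialRange2HoppingFermionInteraction d t'').Φ {x, x + unitVec j} = 0 :=
  axialRange2HoppingFermionInteraction_apply_eq_zero t'' fun y i => pair_unitVec_ne_pair_axial2Vec x j y i

/-- The nearest-neighbour Hubbard interaction vanishes on axial range-2 pairs. [cite: arXiv9311033, §2] -/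
theorem hubbardFermionInteraction_apply_pair_axial2Vec (t U : ℝ) (x : Site d) (i : Fin d) :
    (hubbardFermionInteraction d t U).Φ {x, x + axial2Vec i} = 0 :=
  hubbardFermionInteraction_apply_eq_zero t U (fun y h => singleton_ne_pair_axial2Vec y x i h.symm)
    fun y j h => pair_unitVec_ne_pair_axial2Vec y j x i h.symm

/-- A diagonal pair of `ℤ²` is not an axial range-2 pair (`e₁ ± e₂ ≠ ± 2e_i`: the jump `e₁ ± e₂` has
no zero coordinate). [folklore] -/
private theorem pair_diagVec_ne_pair_axial2Vec (y : Site 2) (s : Fin 2) (x : Site 2) (i : Fin 2) :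
    ({y, y + diagVec s} : Finset (Site 2)) ≠ {x, x + axial2Vec i} := by
  intro h
  have key := eq_or_eq_neg_of_pair_eq_pair (diagVec_ne_zero s) h
  obtain ⟨j, hj⟩ : ∃ j : Fin 2, j ≠ i := ⟨i + 1, by fin_cases i <;> decide⟩
  have h0 : (axial2Vec i : Site 2) j = 0 := axial2Vec_apply_of_ne hj
  have h1 := abs_diagVec_apply s j
  rcases key with k | k
  · rw [k, h0] at h1; norm_num at h1
  · rw [k, Pi.neg_apply, h0] at h1; norm_num at h1

/-- The axial range-2 hopping interaction of `ℤ²` vanishes on diagonal pairs. [cite: PavariniEtAl2001, eq. (1)] -/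
theorem axialRange2HoppingFermionInteraction_apply_pair_diagVec (x : Site 2) (s : Fin 2) :
    (axialRange2HoppingFermionInteraction 2 t'').Φ {x, x + diagVec s} = 0 :=
  axialRange2HoppingFermionInteraction_apply_eq_zero t'' fun y i => pair_diagVec_ne_pair_axial2Vec x s y i

/-- The diagonal hopping interaction vanishes on axial range-2 pairs. [cite: XuEtAl2024, eq. (1)] -/
theorem diagHoppingFermionInteraction_apply_pair_axial2Vec (t' : ℝ) (x : Site 2) (i : Fin 2) :
    (diagHoppingFermionInteraction t').Φ {x, x + axial2Vec i} = 0 :=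
  diagHoppingFermionInteraction_apply_eq_zero t' fun y s h => pair_diagVec_ne_pair_axial2Vec y s x i h.symm

end Terms


end Literature.MathematicalPhysics.QuantumLattice

end
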